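import Literature.AlgebraicGeometry.AbelianSchemes.AbelianSchemeDualIsogenyHom
import Literature.AlgebraicGeometry.AbelianSchemes.ExistsAmpleOfSymmetricWitnesses
import Literature.AlgebraicGeometry.AbelianSchemes.IsLambdaOfAtPullbackWitness
import Literature.AlgebraicGeometry.AbelianVarieties.SymmetricDivisorClassPullback
import Mathlib.NumberTheory.Multiplicity
import HarnessLib

/-!
# `exists_ample` for a descended polarisation from the MULTIPLIED identity `[n]_B ≫ (π ≫ λ′ ≫ π^∨) = λ_B ≫ [d²]_{B̂}`, `d` odd

Layer `Literature/AlgebraicGeometry/AbelianSchemes`, namespace `Literature.AlgebraicGeometry.AbelianSchemes.AbelianSchemeOver`.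
THEOREMS ONLY.  Cell hodgecm-mathlib (D-0151), Hecke-link socket (B), (X-amp) plan of record — the LAST generic step of
`polB.exists_ample` at a geometric point: for a homomorphism `π : B → A′` of abelian schemes (the `φ_d` of the Hecke quotient) with
the honest (b′) identity `[n]_B ≫ (π ≫ λ′ ≫ π^∨) = λ_B ≫ [c]_{B̂}` (★ B-p14 `mulN_comp_mulNDesc_comp_comp_dualIsogenyOver`, `c = d²`),
a SYMMETRIC ample witness `Θ′` of `λ̄′` at `s` ((h1) ★ B-p19 `PolarizationSymmetricWitness`), and a SYMMETRIC witness `E₄` of `λ̄_B⁴`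
((X-amp-1) ★ B-p05 `exists_symmetric_isLambdaOfAt_polarizationDesc_pow_four`), with `c ≡ 1 (mod 4)` — automatic for `c = d²`,
`d` odd (`d² ≡ 1 (mod 8)`): an AMPLE witness of `λ̄_B` at `s` (★ (X-amp-2) `IsLambdaOfAt.pow_nsmul_of_mulN_comp_eq` + ★ B-p19
`symmetric_nsmul_pullback_fibreHom` ⇒ `Θ₀ := n • π_s^*Θ′` ample symmetric witness of `λ̄_B^c`; then ★ (X-amp-3)
`exists_isAmple_isLambdaOfAt_of_symmetric_witnesses_of_pow` with `m = 4`).  [MumfordAV1970] §8, §23; [MumfordFogartyKirwan1994] Ch. 6 §2.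

* `sq_eq_four_mul_add_one_of_odd` — `d` odd ⇒ `d² = 4k + 1` (with `k = (d²−1)/4`);
* **`exists_isAmple_isLambdaOfAt_of_mulN_comp_eq`** — the head.

## References

* [MumfordAV1970] D. Mumford, *Abelian Varieties* (1970), §8 (pp. 74–75), §23 (Thm. 2, p. 231), §6 Application 1 (p. 60).
* [MumfordFogartyKirwan1994] D. Mumford, J. Fogarty, F. Kirwan, *GIT*, 3rd ed., Ch. 6 §2 Definitions 6.2–6.3 and (6.3) (pp. 120–121).
-/

noncomputable section

universe u

open CategoryTheory CategoryTheory.Limits AlgebraicGeometry MonoidalCategory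

namespace Literature.AlgebraicGeometry.AbelianSchemes

open Literature.AlgebraicGeometry.Motives Literature.AlgebraicGeometry.AbelianVarieties Literature.AlgebraicGeometry.Modules
open scoped MonObj

/-- `d` odd ⇒ `d² = 4·((d²−1)/4) + 1` (indeed `d² ≡ 1 (mod 8)`). [cite: MumfordAV1970, §23 (Thm. 2, p. 231)] -/
theorem sq_eq_four_mul_add_one_of_odd {d : ℕ} (hd : Odd d) : d ^ 2 = 4 * ((d ^ 2 - 1) / 4) + 1 := by
  obtain ⟨j, rfl⟩ := hd
  have h : (2 * j + 1) ^ 2 = 4 * (j * j + j) + 1 := by ring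
  rw [h, Nat.add_sub_cancel, Nat.mul_div_cancel_left _ (by norm_num : 0 < 4)]

namespace AbelianSchemeOver

variable {S : Scheme.{u}} {B A' : AbelianSchemeOver S} (π : B.X ⟶ A'.X) [IsMonHom π] (DB : B.DualPair) (D' : A'.DualPair)
  {Ω : Type u} [Field Ω] [IsAlgClosed Ω] (s : Spec (.of Ω) ⟶ S)

/-- **`exists_ample` FROM THE MULTIPLIED IDENTITY** (per geometric point): `π : B → A′` a homomorphism with `π_s` finite dominant,
`[n]_B ≫ (π ≫ λ′ ≫ π^∨) = λ_B ≫ [c]_{B̂}` with `0 < n` and `c = 4k + 1` (e.g. `c = d²`, `d` odd), `Θ′` an ample SYMMETRIC witness of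
`λ̄′` at `s`, `E₄` a SYMMETRIC witness of `λ̄_B⁴` at `s` ⟹ an AMPLE witness of `λ̄_B` at `s`.
[cite: MumfordAV1970, §8 (pp. 74–75) and §23 (Thm. 2, p. 231)] [cite: MumfordFogartyKirwan1994, Ch. 6 §2 Definition 6.2–6.3 (p. 120)] -/
theorem exists_isAmple_isLambdaOfAt_of_mulN_comp_eq [IsReduced S] [IsLocallyNoetherian S]
    (hDB : Nonempty ((Scheme.Modules.pullback (DualPair.unitHatSlice DB)).obj DB.P ≅ SheafOfModules.unit _))
    [IsAffineHom (AbelianVariety.Hom.toSchemeHom (fibreHom π s))] [IsDominant (AbelianVariety.Hom.toSchemeHom (fibreHom π s))]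
    {lam' : A'.X ⟶ D'.hat.X} [IsMonHom lam'] [IsMonHom (DualPair.dualIsogenyOver π DB D')]
    {lamB : B.X ⟶ DB.hat.X} [IsMonHom lamB] [IsMonHom (lamB ^ 4)] {n c k : ℕ} (hn : 0 < n) (hc : c = 4 * k + 1)
    (hmul : B.mulN n ≫ (π ≫ lam' ≫ DualPair.dualIsogenyOver π DB D') = lamB ≫ DB.hat.mulN c)
    {Θ' : CartierDivisor (A'.fibre s).toAbelianVariety.X.left} (hΘ'amp : Θ'.IsAmple) (hΘ' : A'.IsLambdaOfAt s D' lam' Θ')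
    (hΘ'sym : (Θ'.classPullback ((𝟙 (A'.fibre s).toAbelianVariety.X)⁻¹ :
      (A'.fibre s).toAbelianVariety.X ⟶ (A'.fibre s).toAbelianVariety.X).left).LinEquiv Θ')
    {E₄ : CartierDivisor (B.fibre s).toAbelianVariety.X.left} (hE₄ : B.IsLambdaOfAt s DB (lamB ^ 4) E₄)
    (hE₄sym : (E₄.classPullback ((𝟙 (B.fibre s).toAbelianVariety.X)⁻¹ :
      (B.fibre s).toAbelianVariety.X ⟶ (B.fibre s).toAbelianVariety.X).left).LinEquiv E₄) :
    ∃ Θ : CartierDivisor (B.fibre s).toAbelianVariety.X.left, Θ.IsAmple ∧ B.IsLambdaOfAt s DB lamB Θ := by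
  -- `Θ₀ := n • π_s^*Θ′`: an ample symmetric witness of `λ̄_B^c`
  have h₀ : B.IsLambdaOfAt s DB (lamB ^ c) (n • Θ'.pullback (AbelianVariety.Hom.toSchemeHom (fibreHom π s))) :=
    IsLambdaOfAt.pow_nsmul_of_mulN_comp_eq DB s hmul (IsLambdaOfAt.pullback_dualIsogeny π DB D' s lam' Θ' hΘ')
  have hΘ₀amp : (n • Θ'.pullback (AbelianVariety.Hom.toSchemeHom (fibreHom π s))).IsAmple :=
    (isAmple_pullback_fibreHom π s hΘ'amp).smul hn
  have hΘ₀sym := symmetric_nsmul_pullback_fibreHom π s n hΘ'sym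
  exact exists_isAmple_isLambdaOfAt_of_symmetric_witnesses_of_pow B DB s hDB hc hΘ₀amp h₀ hE₄ hΘ₀sym hE₄sym

/-- The same with `c = d²`, `d` odd (the Hecke quotient: `d = N′/N`, v6 socket `hodd`). [cite: MumfordAV1970, §23 (Thm. 2, p. 231)] -/
theorem exists_isAmple_isLambdaOfAt_of_mulN_comp_eq_sq [IsReduced S] [IsLocallyNoetherian S]
    (hDB : Nonempty ((Scheme.Modules.pullback (DualPair.unitHatSlice DB)).obj DB.P ≅ SheafOfModules.unit _))
    [IsAffineHom (AbelianVariety.Hom.toSchemeHom (fibreHom π s))] [IsDominant (AbelianVariety.Hom.toSchemeHom (fibreHom π s))]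
    {lam' : A'.X ⟶ D'.hat.X} [IsMonHom lam'] [IsMonHom (DualPair.dualIsogenyOver π DB D')]
    {lamB : B.X ⟶ DB.hat.X} [IsMonHom lamB] [IsMonHom (lamB ^ 4)] {n d : ℕ} (hn : 0 < n) (hd : Odd d)
    (hmul : B.mulN n ≫ (π ≫ lam' ≫ DualPair.dualIsogenyOver π DB D') = lamB ≫ DB.hat.mulN (d ^ 2))
    {Θ' : CartierDivisor (A'.fibre s).toAbelianVariety.X.left} (hΘ'amp : Θ'.IsAmple) (hΘ' : A'.IsLambdaOfAt s D' lam' Θ')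
    (hΘ'sym : (Θ'.classPullback ((𝟙 (A'.fibre s).toAbelianVariety.X)⁻¹ :
      (A'.fibre s).toAbelianVariety.X ⟶ (A'.fibre s).toAbelianVariety.X).left).LinEquiv Θ')
    {E₄ : CartierDivisor (B.fibre s).toAbelianVariety.X.left} (hE₄ : B.IsLambdaOfAt s DB (lamB ^ 4) E₄)
    (hE₄sym : (E₄.classPullback ((𝟙 (B.fibre s).toAbelianVariety.X)⁻¹ :
      (B.fibre s).toAbelianVariety.X ⟶ (B.fibre s).toAbelianVariety.X).left).LinEquiv E₄) :
    ∃ Θ : CartierDivisor (B.fibre s).toAbelianVariety.X.left, Θ.IsAmple ∧ B.IsLambdaOfAt s DB lamB Θ :=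
  exists_isAmple_isLambdaOfAt_of_mulN_comp_eq π DB D' s hDB hn (sq_eq_four_mul_add_one_of_odd hd) hmul hΘ'amp hΘ' hΘ'sym
    hE₄ hE₄sym

/-! ## §3 Consumer-shaped head (ed.2): the instance side conditions discharged by name

At the Hecke quotient `Q = A/K` the three instance binders of §2 that typeclass inference cannot supply are THEOREMS of the
tree: `IsMonHom (π^∨)` is ★ `DualPair.isMonHom_dualIsogenyOver` (reduced base, both unit hypotheses), `IsMonHom (λ_B ^ 4)` is
`isMonHom_pow` below (commutativity of `B̂` over a reduced base, ★ `isCommMonObj_of_isReduced_base`), and `π_s` affine and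
dominant follow from `π_s` an isogeny.  The head `exists_isAmple_isLambdaOfAt_of_mulN_comp_eq_mul_self` takes exactly the
(b′) export `… = λ_B ≫ [d·d]_{B̂}` of ★ `mulN_comp_mulNDesc_comp_comp_dualIsogenyOver` (token `d * d`) and `Odd d`. -/

/-- **`f ^ m` is a homomorphism** for a homomorphism `f : T → N` into an abelian scheme `N` that is a COMMUTATIVE group scheme
(`f ^ m = f ≫ [m]_N` and ★ `isMonHom_mulN`).  A theorem, not an instance. [cite: MumfordFogartyKirwan1994, Ch. 6 §1 Corollary 6.5 (p. 117)] -/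
theorem isMonHom_pow (N : AbelianSchemeOver S) [IsCommMonObj N.X] {T : Over S} [MonObj T] (f : T ⟶ N.X) [IsMonHom f]
    (m : ℕ) : IsMonHom (f ^ m) := by
  have h : f ^ m = f ≫ N.mulN m := by rw [mulN_def, MonObj.comp_pow, Category.comp_id]
  rw [h]
  haveI := N.isMonHom_mulN m
  infer_instance

/-- **`exists_ample` FROM THE MULTIPLIED IDENTITY, consumer-shaped** (per geometric point `s`, `Ω` algebraically closed; base
reduced and locally Noetherian): `π : B → A′` a homomorphism whose fibre `π_s` is an ISOGENY, both dual pairs with the unit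
hypothesis, `[n]_B ≫ (π ≫ λ′ ≫ π^∨) = λ_B ≫ [d·d]_{B̂}` with `0 < n` and `d` odd, `Θ′` an ample SYMMETRIC witness of `λ̄′` at `s`,
`E₄` a SYMMETRIC witness of `λ̄_B⁴` at `s` ⟹ an AMPLE witness of `λ̄_B` at `s` — §2 with `IsMonHom (π^∨)`, `IsMonHom (λ_B⁴)`,
`IsAffineHom π_s`, `IsDominant π_s` discharged. [cite: MumfordAV1970, §8 (pp. 74–75) and §23 (Thm. 2, p. 231)]
[cite: MumfordFogartyKirwan1994, Ch. 6 §1 Corollary 6.4–6.5 (p. 117) and §2 Definition 6.2–6.3 (p. 120)] -/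
theorem exists_isAmple_isLambdaOfAt_of_mulN_comp_eq_mul_self [IsReduced S] [IsLocallyNoetherian S]
    (hDB : Nonempty ((Scheme.Modules.pullback (DualPair.unitHatSlice DB)).obj DB.P ≅ SheafOfModules.unit _))
    (hD' : Nonempty ((Scheme.Modules.pullback (DualPair.unitHatSlice D')).obj D'.P ≅ SheafOfModules.unit _))
    (hπs : AbelianVariety.IsIsogeny (fibreHom π s))
    {lam' : A'.X ⟶ D'.hat.X} [IsMonHom lam'] {lamB : B.X ⟶ DB.hat.X} [IsMonHom lamB] {n d : ℕ} (hn : 0 < n) (hd : Odd d)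
    (hmul : B.mulN n ≫ (π ≫ lam' ≫ DualPair.dualIsogenyOver π DB D') = lamB ≫ DB.hat.mulN (d * d))
    {Θ' : CartierDivisor (A'.fibre s).toAbelianVariety.X.left} (hΘ'amp : Θ'.IsAmple) (hΘ' : A'.IsLambdaOfAt s D' lam' Θ')
    (hΘ'sym : (Θ'.classPullback ((𝟙 (A'.fibre s).toAbelianVariety.X)⁻¹ :
      (A'.fibre s).toAbelianVariety.X ⟶ (A'.fibre s).toAbelianVariety.X).left).LinEquiv Θ')
    {E₄ : CartierDivisor (B.fibre s).toAbelianVariety.X.left} (hE₄ : B.IsLambdaOfAt s DB (lamB ^ 4) E₄)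
    (hE₄sym : (E₄.classPullback ((𝟙 (B.fibre s).toAbelianVariety.X)⁻¹ :
      (B.fibre s).toAbelianVariety.X ⟶ (B.fibre s).toAbelianVariety.X).left).LinEquiv E₄) :
    ∃ Θ : CartierDivisor (B.fibre s).toAbelianVariety.X.left, Θ.IsAmple ∧ B.IsLambdaOfAt s DB lamB Θ := by
  haveI : IsDominant (AbelianVariety.Hom.toSchemeHom (fibreHom π s)) := by haveI := hπs.1; infer_instance
  haveI : IsAffineHom (AbelianVariety.Hom.toSchemeHom (fibreHom π s)) := by haveI := hπs.2; infer_instance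
  haveI : IsMonHom (DualPair.dualIsogenyOver π DB D') := DualPair.isMonHom_dualIsogenyOver π DB D' (hDB := hD') (hD' := hDB)
  haveI : IsCommMonObj DB.hat.X := DB.hat.isCommMonObj_of_isReduced_base
  haveI : IsMonHom (lamB ^ 4) := DB.hat.isMonHom_pow lamB 4
  rw [← sq] at hmul
  exact exists_isAmple_isLambdaOfAt_of_mulN_comp_eq_sq π DB D' s hDB hn hd hmul hΘ'amp hΘ' hΘ'sym hE₄ hE₄sym

end AbelianSchemeOver

end Literature.AlgebraicGeometry.AbelianSchemes

end
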